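import Summits.Ventures.LatticeQCDFlow.TrivializingMaps.CouplingLadderLawAnyGroup

/-!
HONEST FRAMING: exact (Metropolis-corrected) sampling algorithms for lattice gauge theory; figures
of merit are autocorrelation/cost numbers at stated couplings and volumes; no continuum-physics
claim.

# CouplingLadderLogLaw — THE GEOMETRIC-LADDER LAW FOR PARALLEL TEMPERING IN THE COUPLING: UNDER A
# SPECIFIC-HEAT FLOOR `κ/(1+u²)` A LADDER `0 ≤ β_0 ≤ … ≤ β_K` WITH ADJACENT SWAP RATES `≥ α` OBEYS
# `(1 − D)·log((1+β_K)/(1+β_0)) ≤ K·D`, `D = 2√(log(1/α)/κ)`; `SU(n)`: `κ = c·#plaq`, SO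
# `K ≥ ((1−D)/D)·log((1+b)/(1+a)) ≈ ½√(c#plaq/log(1/α))·log((1+b)/(1+a))` — `√VOLUME × LOG(COUPLING RATIO)`
# REPLICAS ARE NECESSARY (lean-2 GEN-11, ours)

Venture-side (OURS).  Cell `lqcd-flow` (pub-lqcd), unit `pub-lqcd-lean-2-g11`, 2026-08-23.  Sequel of
`CouplingLadderLawAnyGroup`: there the necessity law used the MINIMUM of the specific-heat floor over the
whole window (`c#plaq/(1+β_K²)`), which degrades at large `β_K`.  Applying the floor RUNG BY RUNG instead
(`m_j = κ/(1+β_{j+1}²)` on `[β_j, β_{j+1}]`) gives `δ_j ≤ D·√(1+β_{j+1}²) ≤ D(1+β_{j+1})`, hence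
`(1−D)δ_j ≤ D(1+β_j)` and `log(1+β_{j+1}) − log(1+β_j) ≤ δ_j/(1+β_j) ≤ D/(1−D)`: the admissible rungs are
at most GEOMETRIC in `1+β`, and `K ≥ ((1−D)/D)·log((1+β_K)/(1+β_0))` — the tempering twin of theory2's
`log²` layer law for annealing (items 125 / 130: there `Θ(volume·log²)` LAYERS, here `Θ(√volume·log)`
REPLICAS, necessity side).

* §1 `ladder_log_law` — the pure real-variable lemma (any `κ > 0`, `ℓ ≥ 0`, `D = 2√(ℓ/κ) < 1`, monotone
  ladder from `β_0 ≥ 0`, rung hypothesis `κ/(1+β_{j+1}²)·(β_{j+1}−β_j)² ≤ 4ℓ`).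
* §2 **`wilson_ladder_log_law_sun`** (`SU(n)`, `n ≥ 2`, `d ≥ 2`): one `c = c(n,d) > 0` (item 129's
  all-coupling floor) such that for every `L ≥ 2`, every monotone coupling ladder `0 ≤ β_0 ≤ … ≤ β_K`, every
  `0 < α ≤ 1` with `D = 2√(log(1/α)/(c#plaq)) < 1`: all adjacent swap rates `≥ α` imply
  `(1 − D)·log((1+β_K)/(1+β_0)) ≤ K·D`.

Literature grade (cell rule): KNOWN MECHANISM (geometric temperature ladders for `c_V ∝ 1/T²`-type specific
heats: Kofke 2002, Predescu et al. 2004; Katzgraber arXiv:0905.1629 p. 21), NEW TYPING for `SU(n)` lattice gauge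
theory with theory2's polynomial specific-heat floor; nothing cited as a fact.  NOT CLAIMED: the matching
sufficiency (no `O(#plaq/(1+u²))` ceiling in the tree); sharpness of `c`; anything finite-sample.
-/

noncomputable section

open MeasureTheory ProbabilityTheory Real Set
open Literature.MathematicalPhysics.QuantumFieldTheory
open Literature.MathematicalPhysics.QuantumFieldTheory.Luscher2010
open Summit.Ventures.LatticeQCDFlow.Scaling
open scoped Matrix Matrix.Norms.Frobenius ContDiff

namespace Summit.Ventures.LatticeQCDFlow.TrivializingMaps

/-! ## §1 The real-variable lemma -/

section Arithmetic

/-- **One rung**: if `0 ≤ x ≤ y`, `0 ≤ D < 1` and `(y − x)² ≤ D²(1 + y²)` then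
`(1 − D)·(log(1+y) − log(1+x)) ≤ D`. [ours] -/
theorem rung_log_le {x y D : ℝ} (hx : 0 ≤ x) (hxy : x ≤ y) (hD0 : 0 ≤ D) (hD1 : D < 1)
    (h : (y - x) ^ 2 ≤ D ^ 2 * (1 + y ^ 2)) :
    (1 - D) * (Real.log (1 + y) - Real.log (1 + x)) ≤ D := by
  have hy : 0 ≤ y := hx.trans hxy
  have hδ : 0 ≤ y - x := sub_nonneg.2 hxy
  -- `y − x ≤ D(1+y)`
  have h1 : (y - x) ^ 2 ≤ (D * (1 + y)) ^ 2 := by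
    refine h.trans ?_
    rw [mul_pow]
    exact mul_le_mul_of_nonneg_left (by nlinarith) (sq_nonneg D)
  have h2 : y - x ≤ D * (1 + y) := by
    have := Real.sqrt_le_sqrt h1
    rwa [Real.sqrt_sq hδ, Real.sqrt_sq (by positivity)] at this
  -- hence `(1 − D)(y − x) ≤ D(1 + x)`
  have h3 : (1 - D) * (y - x) ≤ D * (1 + x) := by nlinarith
  -- `log(1+y) − log(1+x) ≤ (y−x)/(1+x)`
  have hx1 : 0 < 1 + x := by linarith
  have hy1 : 0 < 1 + y := by linarith
  have h4 : Real.log (1 + y) - Real.log (1 + x) ≤ (y - x) / (1 + x) := by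
    rw [← Real.log_div hy1.ne' hx1.ne']
    have h5 := Real.log_le_sub_one_of_pos (div_pos hy1 hx1)
    have h6 : (1 + y) / (1 + x) - 1 = (y - x) / (1 + x) := by field_simp; ring
    linarith
  calc (1 - D) * (Real.log (1 + y) - Real.log (1 + x)) ≤ (1 - D) * ((y - x) / (1 + x)) :=
        mul_le_mul_of_nonneg_left h4 (by linarith)
    _ = (1 - D) * (y - x) / (1 + x) := by ring
    _ ≤ D * (1 + x) / (1 + x) := div_le_div_of_nonneg_right h3 hx1.le
    _ = D := by field_simp

/-- **THE GEOMETRIC-LADDER LAW (pure form)**: `κ > 0`, `ℓ ≥ 0`, `D = 2√(ℓ/κ) < 1`, a monotone ladder `β`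
with `β_0 ≥ 0` whose every rung satisfies `κ/(1+β_{j+1}²)·(β_{j+1} − β_j)² ≤ 4ℓ`:
`(1 − D)·log((1+β_K)/(1+β_0)) ≤ K·D`. [ours] -/
theorem ladder_log_law {κ ℓ : ℝ} (hκ : 0 < κ) (hℓ : 0 ≤ ℓ) (K : ℕ) (β : ℕ → ℝ) (hβ : Monotone β)
    (h0 : 0 ≤ β 0) (hD : 2 * sqrt (ℓ / κ) < 1)
    (hrung : ∀ j < K, κ / (1 + β (j + 1) ^ 2) * (β (j + 1) - β j) ^ 2 ≤ 4 * ℓ) :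
    (1 - 2 * sqrt (ℓ / κ)) * Real.log ((1 + β K) / (1 + β 0)) ≤ K * (2 * sqrt (ℓ / κ)) := by
  set D : ℝ := 2 * sqrt (ℓ / κ) with hDdef
  have hD0 : 0 ≤ D := by positivity
  have hDsq : D ^ 2 = 4 * (ℓ / κ) := by
    rw [hDdef, mul_pow, sq_sqrt (div_nonneg hℓ hκ.le)]; norm_num
  have hpos : ∀ j, 0 ≤ β j := fun j => h0.trans (hβ (Nat.zero_le j))
  -- per rung
  have hstep : ∀ j < K, (1 - D) * (Real.log (1 + β (j + 1)) - Real.log (1 + β j)) ≤ D := by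
    intro j hj
    refine rung_log_le (hpos j) (hβ (Nat.le_succ j)) hD0 hD ?_
    · have hr := hrung j hj
      have h1y : 0 < 1 + β (j + 1) ^ 2 := by positivity
      rw [div_mul_eq_mul_div, div_le_iff₀ h1y] at hr
      rw [hDsq]
      have : (β (j + 1) - β j) ^ 2 ≤ 4 * ℓ * (1 + β (j + 1) ^ 2) / κ := by
        rw [le_div_iff₀ hκ]; linarith
      calc (β (j + 1) - β j) ^ 2 ≤ 4 * ℓ * (1 + β (j + 1) ^ 2) / κ := this
        _ = 4 * (ℓ / κ) * (1 + β (j + 1) ^ 2) := by ring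
  -- telescope
  have hsum : ∑ j ∈ Finset.range K, (Real.log (1 + β (j + 1)) - Real.log (1 + β j)) =
      Real.log (1 + β K) - Real.log (1 + β 0) := Finset.sum_range_sub (fun j => Real.log (1 + β j)) K
  have hKD : ∑ j ∈ Finset.range K, (1 - D) * (Real.log (1 + β (j + 1)) - Real.log (1 + β j)) ≤ K * D := by
    calc ∑ j ∈ Finset.range K, (1 - D) * (Real.log (1 + β (j + 1)) - Real.log (1 + β j))
        ≤ ∑ _j ∈ Finset.range K, D := Finset.sum_le_sum fun j hj => hstep j (Finset.mem_range.1 hj)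
      _ = K * D := by rw [Finset.sum_const, Finset.card_range, nsmul_eq_mul]
  rw [← Finset.mul_sum, hsum] at hKD
  rwa [Real.log_div (by linarith [hpos K] : (1 + β K) ≠ 0) (by linarith : (1 + β 0) ≠ 0)]

end Arithmetic

/-! ## §2 `SU(n)`: `√volume × log(coupling ratio)` replicas are necessary -/

section SUN

variable {d n : ℕ}

/-- **THE GEOMETRIC-LADDER LAW FOR `SU(n)` PARALLEL TEMPERING IN THE COUPLING** (`n ≥ 2`, `d ≥ 2`): there
is `c = c(n,d) > 0` such that for every `L ≥ 2`, every monotone coupling ladder `0 ≤ β_0 ≤ … ≤ β_K`, every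
`0 < α ≤ 1` with `D := 2√(log(1/α)/(c·#plaq)) < 1`, if every adjacent swap rate is `≥ α` then
**`(1 − D)·log((1+β_K)/(1+β_0)) ≤ K·D`** — i.e. `K ≥ ((1−D)/D)·log((1+β_K)/(1+β_0))`, of order
`√(c·#plaq/log(1/α))·log((1+b)/(1+a))`. [ours] -/
theorem wilson_ladder_log_law_sun (hn : 2 ≤ n) (hd : 2 ≤ d) :
    ∃ c : ℝ, 0 < c ∧ ∀ (L : ℕ) [NeZero L], 2 ≤ L → ∀ (K : ℕ) (β : ℕ → ℝ), Monotone β → 0 ≤ β 0 →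
      ∀ α : ℝ, 0 < α → α ≤ 1 →
        2 * sqrt (Real.log (1 / α) / (c * Fintype.card (Plaquette d L))) < 1 →
        (∀ j < K, α ≤ swapAcc (fun U => -wilsonAction (StrongCoupling.defRep n) U)
          (trivialMeasure (Matrix.specialUnitaryGroup (Fin n) ℂ) d L) (β j) (β (j + 1))) →
        (1 - 2 * sqrt (Real.log (1 / α) / (c * Fintype.card (Plaquette d L)))) *
            Real.log ((1 + β K) / (1 + β 0)) ≤
          K * (2 * sqrt (Real.log (1 / α) / (c * Fintype.card (Plaquette d L)))) := by
  obtain ⟨c, hc, h⟩ := wilson_variance_floor_allCouplings_rep (d := d) (n := n) hn hd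
  refine ⟨c, hc, fun L _ hL K β hβ h0 α hα hα1 hD hacc => ?_⟩
  have hρ : Continuous (StrongCoupling.defRep n) := continuous_subtype_val
  have hP : 0 < (Fintype.card (Plaquette d L) : ℝ) := by
    exact_mod_cast Theory2.HaarStart.card_plaquette_pos (d := d) hd L
  have hκ : 0 < c * Fintype.card (Plaquette d L) := mul_pos hc hP
  have hℓ : 0 ≤ Real.log (1 / α) := Real.log_nonneg (by rw [le_div_iff₀ hα]; linarith)
  have hpos : ∀ j, 0 ≤ β j := fun j => h0.trans (hβ (Nat.zero_le j))
  refine ladder_log_law hκ hℓ K β hβ h0 hD fun j hj => ?_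
  -- the rung floor `c#plaq/(1+β_{j+1}²)` on `[β_j, β_{j+1}]`
  have hfl : ∀ u ∈ Icc (β j) (β (j + 1)), c * Fintype.card (Plaquette d L) / (1 + β (j + 1) ^ 2) ≤
      variance (wilsonAction (d := d) (L := L) (StrongCoupling.defRep n))
        (wilsonMeasure (d := d) (L := L) (StrongCoupling.defRep n) u) := by
    intro u hu
    have hu0 : 0 ≤ u := (hpos j).trans hu.1
    refine le_trans ?_ (h L hL u hu0)
    have hu1 : 1 + u ^ 2 ≤ 1 + β (j + 1) ^ 2 := by nlinarith [hu.2, hu0]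
    exact div_le_div_of_nonneg_left hκ.le (by positivity) hu1
  have hA := (hacc j hj).trans
    (wilson_swapAcc_le_of_floor (d := d) (L := L) (StrongCoupling.defRep n) hρ (hβ (Nat.le_succ j)) hfl)
  have hlog := (Real.log_le_iff_le_exp hα).2 hA
  rw [one_div, Real.log_inv]
  linarith

end SUN

end Summit.Ventures.LatticeQCDFlow.TrivializingMaps

end
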